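import Literature.NumberTheory.AdelicBaseChange.IntegralClosureLocalization
import Mathlib.NumberTheory.Cyclotomic.Basic
import Mathlib.FieldTheory.SplittingField.Construction
import Mathlib.NumberTheory.NumberField.Basic
import HarnessLib

/-!
# K-DATA for the REC stubs of skeleton v8: a number field `K ⊇ ℚ(ζ_m)` containing an `e`-th root of `p`, and places `w′ ∣ w`
# (route `EdixhovenFibreFiveSeven`, crux K★ stmt-BirchSwinnertonDyer-22226, line `kato-lever`; seat `bsd-line-edix-p1` g30, LEAD)

HONEST FRAMING. TOOL theorems only (no definition, no named fact, no instance, no `sorry`); nothing is closed; BSD / K★ / the REC stubs are NOT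
proved by this. Elementary algebraic number theory, recorded in the exact shape the turnkey theorem
`…RecTowerAtCyclotomicOverCompletion.recTowerAt_cyclotomic_cells_of_formula_over_completion` consumes its upper field: a number field `K` with
`[Algebra (CyclotomicField m ℚ) K] [FiniteDimensional (CyclotomicField m ℚ) K]`, a place `w′ : w.Extension (𝓞 K)` with `(p : 𝓞 K) ∈ w′`.

* `nonempty_extension` — every finite place `w` of a number field `F` extends to any finite extension `K/F` (a prime of `𝓞 K` above `w`,
  Mathlib `Ideal.nonempty_primesOver`, read through the packet's `Extension.equivPrimesOver`).
* `natCast_mem_extension` — `(n : 𝓞 F) ∈ w ⟹ (n : 𝓞 K) ∈ w′` for `w′ ∣ w`.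
* `exists_numberField_extension_pow_eq` — for `a ∈ F` and `e ≥ 1` there is a finite extension `K/F` (a number field) with an `α ∈ K`, `α^e = a`
  (the splitting field of `X^e − a`; no irreducibility needed).
* ★ `exists_numberField_over_cyclotomic_pow_eq_prime` — for `m`, `e ≥ 1`, `p`: a number field `K ⊇ ℚ(ζ_m)`, finite over `ℚ(ζ_m)`, with `α^e = p`,
  such that every place `w ∣ p` of `ℚ(ζ_m)` has a place `w′ ∣ w` of `K` with `p ∈ w′` — the field `ℚ(ζ_m, p^{1/e})` of good reduction of the
  potentially supersingular K★ cells (`e ∈ {3, 4, 6}`), over whose completions `K_{w′}` the (K₂)^ram road is typed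
  (`EisensteinRoot.exists_poly_eq_X_pow_sub_C` then gives the Eisenstein datum `X^e − p`, root `α`).

References: [CasselsFrohlichANT1967] Ch. II §10; [NeukirchANT1999] Ch. I §8 (primes in extensions); [SilvermanAEC2009] VII.5.5 (the field of good reduction).
-/

set_option autoImplicit false
-- the Theorems namespace of a single-conjunct summit repeats the summit name by design (D-0017)
set_option linter.dupNamespace false

noncomputable section

open scoped NumberField
open Polynomial NumberField IsDedekindDomain

namespace Summit.BirchSwinnertonDyer.BirchSwinnertonDyer.Theorems.StarredOptimalManinUnitFiveSevenRecTowerKData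

/-- **Every finite place of a number field extends to a finite extension**: for number fields `F ⊆ K` and a nonzero prime `w` of `𝓞 F`
there is a nonzero prime `w′` of `𝓞 K` above it (`w′ ∩ 𝓞 F = w`), in the packet's currency `w.Extension (𝓞 K)`.
[cite: NeukirchANT1999, Ch. I §8, Prop. 8.1–8.2] -/
theorem nonempty_extension {F K : Type} [Field F] [NumberField F] [Field K] [NumberField K] [Algebra F K]
    (w : HeightOneSpectrum (𝓞 F)) : Nonempty (w.Extension (𝓞 K)) := by
  obtain ⟨Q⟩ := w.asIdeal.nonempty_primesOver (S := 𝓞 K)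
  exact ⟨(HeightOneSpectrum.Extension.equivPrimesOver (𝓞 F) F K (𝓞 K) w).symm Q⟩

/-- **Membership of a rational integer passes up**: if `(n : 𝓞 F) ∈ w` and `w′ ∣ w` then `(n : 𝓞 K) ∈ w′`. [cite: NeukirchANT1999, Ch. I §8] -/
theorem natCast_mem_extension {F K : Type} [Field F] [NumberField F] [Field K] [NumberField K] [Algebra F K]
    (w : HeightOneSpectrum (𝓞 F)) (w' : w.Extension (𝓞 K)) {n : ℕ} (h : (n : 𝓞 F) ∈ w.asIdeal) :
    (n : 𝓞 K) ∈ w'.1.asIdeal := by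
  have hw : (w'.1.under (𝓞 F)).asIdeal = w.asIdeal := by rw [w'.2]
  have h' : algebraMap (𝓞 F) (𝓞 K) (n : 𝓞 F) ∈ w'.1.asIdeal := by
    rw [← Ideal.mem_comap]
    change (n : 𝓞 F) ∈ w'.1.asIdeal.under (𝓞 F)
    rw [← HeightOneSpectrum.under_asIdeal, hw]
    exact h
  simpa using h'

/-- **A finite extension with an `e`-th root**: for a number field `F`, `a ∈ F` and `e ≥ 1` there is a number field `K ⊇ F`, finite over `F`, with
an `α ∈ K`, `α ^ e = a` (the splitting field of `X^e − a`). [cite: NeukirchANT1999, Ch. I §2] -/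
theorem exists_numberField_extension_pow_eq (F : Type) [Field F] [NumberField F] {e : ℕ} (he : 0 < e) (a : F) :
    ∃ (K : Type) (_ : Field K) (_ : NumberField K) (_ : Algebra F K) (_ : FiniteDimensional F K) (α : K),
      α ^ e = algebraMap F K a := by
  let f : F[X] := X ^ e - C a
  haveI : CharZero f.SplittingField := charZero_of_injective_algebraMap (algebraMap F _).injective
  haveI : FiniteDimensional ℚ f.SplittingField := Module.Finite.trans F f.SplittingField
  haveI : NumberField f.SplittingField := NumberField.mk
  have hdeg : (f.map (algebraMap F f.SplittingField)).degree ≠ 0 := by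
    rw [degree_map, degree_X_pow_sub_C he]
    exact_mod_cast he.ne'
  obtain ⟨α, hα⟩ := (SplittingField.splits f).exists_eval_eq_zero hdeg
  refine ⟨f.SplittingField, inferInstance, inferInstance, inferInstance, inferInstance, α, ?_⟩
  rw [eval_map, eval₂_sub, eval₂_X_pow, eval₂_C, sub_eq_zero] at hα
  exact hα

/-- ★ **K-DATA of the potentially supersingular K★ cells.** For `m`, `e ≥ 1` and a prime `p` there is a number field `K ⊇ ℚ(ζ_m)`, finite over
`ℚ(ζ_m)`, with an `α ∈ K`, `α ^ e = p`, such that every place `w` of `ℚ(ζ_m)` with `p ∈ w` has a place `w′ ∣ w` of `K` with `p ∈ w′` —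
the field `ℚ(ζ_m, p^{1/e})` of good reduction of the cells over the cyclotomic level `m` (`e = 3, 6` at `p = 5`; `e = 4` at `p = 7`).
[cite: SilvermanAEC2009, VII.5.5] [cite: NeukirchANT1999, Ch. I §8, Prop. 8.1–8.2] -/
theorem exists_numberField_over_cyclotomic_pow_eq_prime (m : ℕ) [NeZero m] {e : ℕ} (he : 0 < e) (p : ℕ) :
    ∃ (K : Type) (_ : Field K) (_ : NumberField K) (_ : Algebra (CyclotomicField m ℚ) K)
      (_ : FiniteDimensional (CyclotomicField m ℚ) K) (α : K), α ^ e = (p : K) ∧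
      ∀ (w : HeightOneSpectrum (𝓞 (CyclotomicField m ℚ))), ((p : ℕ) : 𝓞 (CyclotomicField m ℚ)) ∈ w.asIdeal →
        ∃ w' : w.Extension (𝓞 K), ((p : ℕ) : 𝓞 K) ∈ w'.1.asIdeal := by
  obtain ⟨K, _, _, _, _, α, hα⟩ := exists_numberField_extension_pow_eq (CyclotomicField m ℚ) he (p : CyclotomicField m ℚ)
  refine ⟨K, inferInstance, inferInstance, inferInstance, inferInstance, α, by rw [hα, map_natCast], fun w hw => ?_⟩
  obtain ⟨w'⟩ := nonempty_extension (K := K) w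
  exact ⟨w', natCast_mem_extension w w' hw⟩

end Summit.BirchSwinnertonDyer.BirchSwinnertonDyer.Theorems.StarredOptimalManinUnitFiveSevenRecTowerKData

end
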